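import Mathlib
import HarnessLib
import Summits.CriticalPhenomena.PercolationContinuityZ3.Theses.PercTreeValue
import Summits.CriticalPhenomena.PercolationContinuityZ3.Theorems.PercTreeValueTetrahedronDisjointCoexistenceTransferD
import Summits.CriticalPhenomena.PercolationContinuityZ3.Theorems.PercTreeValueTetrahedronDisjointCoexistenceTransferC
import Summits.CriticalPhenomena.PercolationContinuityZ3.Theorems.PercTreeValueTetrahedronDisjointCoexistenceLinkBoxOfCore
import Summits.CriticalPhenomena.PercolationContinuityZ3.Theorems.PercTreeValueTetrahedronDisjointCoexistenceLinkBoxPositivity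
import Summits.CriticalPhenomena.PercolationContinuityZ3.Theorems.PercTreeValueTetrahedronDisjointCoexistenceLinkRestriction
import Summits.CriticalPhenomena.PercolationContinuityZ3.Theorems.PercTreeValueTetrahedronDisjointCoexistenceLinkBlocking

/-!
# Line `Sketch` — ASSEMBLED form (rev c3): the crux modulo exactly the two open statements

Every provable stub of `Lines/Sketch.lean` is landed (S1 p120307, S2 p120159, S3 p120083, S6 p120474, S7 p120328, S8 p120771,
S9 p120948, S10 p125940, T1 p127055, T2 p127243, L1 p127132, L2 p127220). With the landed transfer
`tetrahedronDisjointCoexistence_of_annulusNonCrossing_of_boxRestriction` (TransferD) the crux is, kernel-checked, a consequence of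
the two OPEN statements below and nothing else:
* `open_annulusNonCrossing` = X_B = stmt-CriticalPhenomena-0846 (`PercAnnulusCrossing.CritAnnulusNonCrossing`, sibling crux);
* `open_boxRestriction` = S5' (van den Berg–Don restriction in box form: `P(0 ↔ a_r inside [−r,2r]² × [−2r, 3⌊r/8⌋]) ≥ c τ(0,a_r)`).
This file is the lead's census instrument (2 sorries); the REGISTRY skeleton (all 15 stubs kept `sorry`) stays `Lines/Sketch.lean`.
-/

noncomputable section

open MeasureTheory
open Literature.Probability.Percolation Literature.Probability.LatticeModels

namespace Summit.CriticalPhenomena.PercolationContinuityZ3.Cruxes.TetrahedronDisjointCoexistence.LineSketchAssembled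

/-- OPEN (sibling crux stmt-CriticalPhenomena-0846, X_B verbatim). -/
theorem open_annulusNonCrossing :
    ∃ c : ℝ, 0 < c ∧ ∀ n : ℕ, 1 ≤ n →
      (bondPercolation (zdGraph 3) (criticalProbI 3)).real
          {ω | ∃ x ∈ box 3 n, ∃ y ∈ innerBoundary (zdGraph 3) (box 3 (2 * n)),
            ω ∈ openConnIn ↑(box 3 (2 * n)) x y} ≤ 1 - c := by
  sorry

/-- OPEN (S5' `stub_boxRestriction`, the line's own residue). -/
theorem open_boxRestriction :
    ∃ c : ℝ, 0 < c ∧ ∃ r₀ : ℕ, ∀ r : ℕ, r₀ ≤ r →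
      c * tau 3 (criticalProbI 3) 0 ![(r : ℤ), (r : ℤ), 0] ≤
        (bondPercolation (zdGraph 3) (criticalProbI 3)).real
          (openConnIn
            {x : Site 3 | -(r : ℤ) ≤ x 0 ∧ x 0 ≤ 2 * (r : ℤ) ∧ -(r : ℤ) ≤ x 1 ∧ x 1 ≤ 2 * (r : ℤ) ∧
              -(2 * (r : ℤ)) ≤ x 2 ∧ x 2 ≤ 3 * ((r : ℤ) / 8)}
            (0 : Site 3) ![(r : ℤ), (r : ℤ), 0]) := by
  sorry

/-- The crux BY NAME from the two open statements, through the landed transfer D. -/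
theorem TetrahedronDisjointCoexistence_of : Theses.PercTreeValue.TetrahedronDisjointCoexistence :=
  Theorems.TetrahedronDisjointCoexistence.tetrahedronDisjointCoexistence_of_annulusNonCrossing_of_boxRestriction
    open_annulusNonCrossing open_boxRestriction

/-- The older residue (c1: X_B ∧ core restriction S5) also gives the crux, two landed ways: directly (TransferC) and through
S5 ⇒ S5' (LinkBoxOfCore) + TransferD. -/
theorem TetrahedronDisjointCoexistence_of_core
    (hCore : ∃ c : ℝ, 0 < c ∧ ∃ r₀ : ℕ, ∀ r : ℕ, r₀ ≤ r →
      c * tau 3 (criticalProbI 3) 0 ![(r : ℤ), (r : ℤ), 0] ≤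
        (bondPercolation (zdGraph 3) (criticalProbI 3)).real
          (openConnIn
            {x : Site 3 | -((r : ℤ) / 8) ≤ x 0 ∧ x 0 ≤ (r : ℤ) + (r : ℤ) / 8 ∧
              -((r : ℤ) / 8) ≤ x 1 ∧ x 1 ≤ (r : ℤ) + (r : ℤ) / 8 ∧
              -((r : ℤ) + (r : ℤ) / 8) ≤ x 2 ∧ x 2 ≤ (r : ℤ) / 8}
            (0 : Site 3) ![(r : ℤ), (r : ℤ), 0])) :
    Theses.PercTreeValue.TetrahedronDisjointCoexistence :=
  Theorems.TetrahedronDisjointCoexistence.tetrahedronDisjointCoexistence_of_annulusNonCrossing_of_boxRestriction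
    open_annulusNonCrossing (Theorems.TetrahedronDisjointCoexistence.stub_boxRestriction_of_coreRestriction hCore)

/-- The line's residue feeds composition B of `SketchIdeator2`: S5' ⇒ S12 (LinkBoxPositivity, landed). -/
theorem restrictionPositivity_of_open :
    ∃ c₁ : ℝ, 0 < c₁ ∧ ∃ r₀ : ℕ, ∀ r : ℕ, r₀ ≤ r →
      c₁ * tau 3 (criticalProbI 3) 0 ![(r : ℤ), (r : ℤ), 0] ≤
        (bondPercolation (zdGraph 3) (criticalProbI 3)).real
          (openConnIn {x : Site 3 | 2 * x 2 + 2 ≤ (r : ℤ)} (0 : Site 3) ![(r : ℤ), (r : ℤ), 0]) :=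
  Theorems.TetrahedronDisjointCoexistence.stub_restrictionPositivity_of_boxRestriction open_boxRestriction

end Summit.CriticalPhenomena.PercolationContinuityZ3.Cruxes.TetrahedronDisjointCoexistence.LineSketchAssembled

end
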